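import Literature.AlgebraicTopology.SingularHomology.CubeSimplexCollapse
import Mathlib.Analysis.Calculus.ContDiff.Operations
import Mathlib.Analysis.Calculus.Deriv.Comp
import Mathlib.Analysis.Calculus.Deriv.Add
import Mathlib.Analysis.Calculus.Deriv.Mul
import HarnessLib

/-!
# The cube-to-simplex collapse `[0,1]ᵏ → Δᵏ`

Support for the integration proof of **de Rham's theorem** (integration of forms over smooth
singular simplices). Instead of parametrising the standard `k`-simplex
`Δᵏ = stdSimplex ℝ (Fin (k + 1))` by a `k`-simplex of `ℝᵏ`, we parametrise it by the CUBE
`[0,1]ᵏ` through the polynomial **collapse map** `cubeToSimplex k : ℝᵏ → ℝᵏ⁺¹`,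

`cubeToSimplex (k+1) (t₀, t') = (1 - t₀, t₀ • cubeToSimplex k t')`,  `cubeToSimplex 0 = (1)`,

i.e. in barycentric coordinates `yⱼ = t₀ ⋯ tⱼ₋₁ (1 - tⱼ)` (`j < k`), `y_k = t₀ ⋯ t_{k-1}`: the
composite of `t ↦ (t₀, t₀t₁, …, t₀⋯t_{k-1})` onto the order simplex `{1 ≥ x₁ ≥ ⋯ ≥ x_k ≥ 0}` with
its identification with `Δᵏ`. This is the classical "collapsed cube" parametrisation of the
simplex (e.g. the map used to compare cubical and simplicial singular theories, Eilenberg–Mac Lane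
1953; Hatcher (2002), proof of Thm. 2.27 / §3.B). Its virtue for Stokes' theorem is that the faces
of the cube go to faces of the simplex *or collapse*:

* `cubeToSimplex_insertNth_one`: the front face `tᵢ = 1` is the facet `δᵢ` (`i < k`, as
  `Fin.castSucc i`): `cubeToSimplex (k+1) (insertNth i 1 x) = insertNth (castSucc i) 0 (cubeToSimplex k x)`;
* `cubeToSimplex_snoc_zero`: the back face `t_{k} = 0` (last coordinate) is the last facet:
  `cubeToSimplex (k+1) (snoc x 0) = snoc (cubeToSimplex k x) 0`;
* `cubeToSimplex_add_single`, `fderiv_cubeToSimplex_single_eq_zero`: on a back face `tᵢ = 0` the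
  map does not depend on the later coordinates `tⱼ`, `j > i`, so its derivative kills `eⱼ` there
  (the other back faces are degenerate: a `(k-1)`-form pulled back to them vanishes);
* `cubeToSimplex_mem_stdSimplex` (`[0,1]ᵏ ↦ Δᵏ`), `sum_cubeToSimplex`, `contDiff_cubeToSimplex`.

so that Stokes' formula for a simplex becomes Mathlib's divergence theorem on a box
(`MeasureTheory.integral_divergence_of_hasFDerivAt_off_countable`). Pure finite-dimensional
calculus; no manifolds here.

**Relation to the tree.** This is the SAME map as the topological collapse
`Literature.AlgebraicTopology.SingularHomology.CubeCollapse.collapse : (Fin n → I) → Δⁿ` of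
`…SingularHomology.CubeSimplexCollapse` (`κ(t)ⱼ = Pⱼ - Pⱼ₊₁`, used there for the homotopy addition
theorem): `cubeToSimplex` is its polynomial extension from the cube `Iⁿ` to the ambient `ℝⁿ`,
which is what `fderiv` / `ContDiff` / the divergence theorem need. The agreement on the cube is
`cubeToSimplex_coe_eq_collapse`; the front-face and last-back-face lemmas below are the ambient
forms of `CubeCollapse.collapse_insertNth_one` / `collapse_insertNth_last_zero`.

## References

* A. Hatcher, *Algebraic Topology* (2002), §2.1 (simplices and their faces), §3.B.
* J. M. Lee, *Introduction to Smooth Manifolds*, 2nd ed. (2013), proof of Thm. 18.12 (Stokes on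
  chains, via a parametrisation of the simplex).
-/

noncomputable section

open Set

namespace Literature.Geometry.Manifold

/-- **The cube-to-simplex collapse** `ℝᵏ → ℝᵏ⁺¹`, by recursion on `k`:
`cubeToSimplex (k+1) t = (1 - t₀, t₀ • cubeToSimplex k (tail t))`, `cubeToSimplex 0 t = 1`.
On `[0,1]ᵏ` it is the tree's `CubeCollapse.collapse` (`cubeToSimplex_coe_eq_collapse`), a surjection
onto the standard simplex `Δᵏ` which is a bijection of the interiors; here extended polynomially to
all of `ℝᵏ` so that it can be differentiated (Hatcher (2002), §4.1, p. 340, collapsing a cube onto a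
simplex). [cite: HatcherAT2002, §4.1 p. 340] -/
def cubeToSimplex : (k : ℕ) → (Fin k → ℝ) → (Fin (k + 1) → ℝ)
  | 0, _ => fun _ ↦ 1
  | k + 1, t => Fin.cons (1 - t 0) (t 0 • cubeToSimplex k (Fin.tail t))

/-- The collapse in dimension `0` is the point `1 ∈ Δ⁰`. [folklore] -/
@[simp]
theorem cubeToSimplex_zero (t : Fin 0 → ℝ) : cubeToSimplex 0 t = fun _ ↦ 1 := rfl

/-- The recursion formula for the collapse. [folklore] -/
theorem cubeToSimplex_succ {k : ℕ} (t : Fin (k + 1) → ℝ) :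
    cubeToSimplex (k + 1) t = Fin.cons (1 - t 0) (t 0 • cubeToSimplex k (Fin.tail t)) := rfl

/-- Zeroth barycentric coordinate of the collapse: `1 - t₀`. [folklore] -/
@[simp]
theorem cubeToSimplex_succ_apply_zero {k : ℕ} (t : Fin (k + 1) → ℝ) :
    cubeToSimplex (k + 1) t 0 = 1 - t 0 := by
  rw [cubeToSimplex_succ, Fin.cons_zero]

/-- Later barycentric coordinates of the collapse: `t₀` times those of the tail. [folklore] -/
@[simp]
theorem cubeToSimplex_succ_apply_succ {k : ℕ} (t : Fin (k + 1) → ℝ) (j : Fin (k + 1)) :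
    cubeToSimplex (k + 1) t j.succ = t 0 * cubeToSimplex k (Fin.tail t) j := by
  rw [cubeToSimplex_succ, Fin.cons_succ, Pi.smul_apply, smul_eq_mul]

/-- **The barycentric coordinates of the collapse sum to `1`.** [folklore] -/
theorem sum_cubeToSimplex : ∀ (k : ℕ) (t : Fin k → ℝ), ∑ j, cubeToSimplex k t j = 1
  | 0, _ => by simp
  | k + 1, t => by
    rw [Fin.sum_univ_succ, cubeToSimplex_succ_apply_zero]
    simp only [cubeToSimplex_succ_apply_succ, ← Finset.mul_sum, sum_cubeToSimplex k]
    ring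

/-- **The barycentric coordinates of the collapse are nonnegative on the cube.** [folklore] -/
theorem cubeToSimplex_nonneg : ∀ (k : ℕ) {t : Fin k → ℝ}, (∀ i, 0 ≤ t i) → (∀ i, t i ≤ 1) →
    ∀ j, 0 ≤ cubeToSimplex k t j
  | 0, _, _, _, _ => by simp
  | k + 1, t, h0, h1, j => by
    cases j using Fin.cases with
    | zero => rw [cubeToSimplex_succ_apply_zero]; linarith [h1 0]
    | succ j =>
      rw [cubeToSimplex_succ_apply_succ]
      exact mul_nonneg (h0 0) (cubeToSimplex_nonneg k (fun i ↦ h0 i.succ) (fun i ↦ h1 i.succ) j)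

/-- **The collapse maps the cube `[0,1]ᵏ` into the standard simplex `Δᵏ`.** [cite: HatcherAT2002, §2.1] -/
theorem cubeToSimplex_mem_stdSimplex {k : ℕ} {t : Fin k → ℝ} (ht : t ∈ Icc (0 : Fin k → ℝ) 1) :
    cubeToSimplex k t ∈ stdSimplex ℝ (Fin (k + 1)) :=
  ⟨cubeToSimplex_nonneg k (fun i ↦ ht.1 i) (fun i ↦ ht.2 i), sum_cubeToSimplex k t⟩

/-- The collapse as a `MapsTo` statement. [folklore] -/
theorem mapsTo_cubeToSimplex (k : ℕ) :
    MapsTo (cubeToSimplex k) (Icc (0 : Fin k → ℝ) 1) (stdSimplex ℝ (Fin (k + 1))) :=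
  fun _ ht ↦ cubeToSimplex_mem_stdSimplex ht

/-- The tail map `ℝᵏ⁺¹ → ℝᵏ` is smooth (it is linear). [folklore] -/
theorem contDiff_fin_tail {k : ℕ} {n : WithTop ℕ∞} :
    ContDiff ℝ n (Fin.tail : (Fin (k + 1) → ℝ) → (Fin k → ℝ)) :=
  contDiff_pi.2 fun i ↦ contDiff_apply ℝ ℝ i.succ

/-- **The collapse is smooth** (it is polynomial). [folklore] -/
theorem contDiff_cubeToSimplex {n : WithTop ℕ∞} : ∀ (k : ℕ), ContDiff ℝ n (cubeToSimplex k)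
  | 0 => by rw [show cubeToSimplex 0 = fun _ _ ↦ (1 : ℝ) from rfl]; exact contDiff_const
  | k + 1 => by
    refine contDiff_pi.2 fun j ↦ ?_
    cases j using Fin.cases with
    | zero =>
      simp only [cubeToSimplex_succ_apply_zero]
      exact contDiff_const.sub (contDiff_apply ℝ ℝ 0)
    | succ j =>
      simp only [cubeToSimplex_succ_apply_succ]
      exact (contDiff_apply ℝ ℝ 0).mul ((contDiff_pi.1 (contDiff_cubeToSimplex k) j).comp
        contDiff_fin_tail)

/-- The collapse is continuous. [folklore] -/
theorem continuous_cubeToSimplex (k : ℕ) : Continuous (cubeToSimplex k) :=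
  (contDiff_cubeToSimplex (n := 0) k).continuous

/-- The collapse is differentiable. [folklore] -/
theorem differentiable_cubeToSimplex (k : ℕ) : Differentiable ℝ (cubeToSimplex k) :=
  (contDiff_cubeToSimplex (n := 1) k).differentiable (by simp)

/-! ### Degenerate faces: independence of later coordinates on `tᵢ = 0` -/

/-- The tail of a vector supported at a successor index. [folklore] -/
theorem fin_tail_single_succ {k : ℕ} (j : Fin k) (h : ℝ) :
    Fin.tail (Pi.single (M := fun _ : Fin (k + 1) ↦ ℝ) j.succ h) = Pi.single j h := by
  ext l
  simp only [Fin.tail, Pi.single_apply, Fin.succ_inj]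

/-- **On the face `tᵢ = 0` the collapse does not depend on the coordinates `tⱼ`, `j > i`**
(all the products `t₀ ⋯ t_m`, `m ≥ i`, vanish there). [folklore] -/
theorem cubeToSimplex_add_single : ∀ (k : ℕ) {t : Fin k → ℝ} {i j : Fin k}, i < j → t i = 0 →
    ∀ h : ℝ, cubeToSimplex k (t + Pi.single j h) = cubeToSimplex k t
  | 0, _, i, _, _, _, _ => i.elim0
  | k + 1, t, i, j, hij, hti, h => by
    have hj0 : j ≠ 0 := fun hj ↦ by rw [hj] at hij; exact (Fin.not_lt_zero i) hij
    obtain ⟨j', rfl⟩ := Fin.eq_succ_of_ne_zero hj0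
    have h0 : (t + Pi.single (M := fun _ : Fin (k + 1) ↦ ℝ) j'.succ h) 0 = t 0 := by
      rw [Pi.add_apply, Pi.single_apply, if_neg (Fin.succ_ne_zero j').symm, add_zero]
    have htail : Fin.tail (t + Pi.single (M := fun _ : Fin (k + 1) ↦ ℝ) j'.succ h) =
        Fin.tail t + Pi.single j' h := by
      rw [show Fin.tail (t + Pi.single (M := fun _ : Fin (k + 1) ↦ ℝ) j'.succ h) =
          Fin.tail t + Fin.tail (Pi.single (M := fun _ : Fin (k + 1) ↦ ℝ) j'.succ h) from rfl,
        fin_tail_single_succ]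
    cases i using Fin.cases with
    | zero =>
      rw [cubeToSimplex_succ, cubeToSimplex_succ, h0, hti, zero_smul, zero_smul]
    | succ i' =>
      rw [cubeToSimplex_succ, cubeToSimplex_succ, h0, htail,
        cubeToSimplex_add_single k (Fin.succ_lt_succ_iff.1 hij) hti h]

/-- **The derivative of the collapse kills `eⱼ` on the face `tᵢ = 0`, `j > i`** (directional
derivative of a function constant along that direction). [folklore] -/
theorem fderiv_cubeToSimplex_single_eq_zero {k : ℕ} {t : Fin k → ℝ} {i j : Fin k} (hij : i < j)
    (hti : t i = 0) : fderiv ℝ (cubeToSimplex k) t (Pi.single j 1) = 0 := by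
  -- the line `s ↦ t + s eⱼ` and the (constant) restriction of the collapse to it
  have hline : HasDerivAt (fun s : ℝ ↦ t + s • Pi.single (M := fun _ : Fin k ↦ ℝ) j 1)
      (Pi.single j 1) 0 := by
    simpa using ((hasDerivAt_id (0 : ℝ)).smul_const (Pi.single (M := fun _ : Fin k ↦ ℝ) j 1)).const_add t
  have hcomp : HasDerivAt (fun s : ℝ ↦ cubeToSimplex k (t + s • Pi.single (M := fun _ : Fin k ↦ ℝ) j 1))
      (fderiv ℝ (cubeToSimplex k) t (Pi.single j 1)) 0 :=
    HasFDerivAt.comp_hasDerivAt_of_eq (x := (0 : ℝ))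
      ((differentiable_cubeToSimplex k _).hasFDerivAt) hline (by simp)
  have hconst : (fun s : ℝ ↦ cubeToSimplex k (t + s • Pi.single (M := fun _ : Fin k ↦ ℝ) j 1)) =
      fun _ ↦ cubeToSimplex k t := by
    funext s
    have hs : s • Pi.single (M := fun _ : Fin k ↦ ℝ) j (1 : ℝ) = Pi.single j s := by
      ext l
      simp only [Pi.smul_apply, Pi.single_apply, smul_eq_mul, mul_ite, mul_one, mul_zero]
    rw [hs, cubeToSimplex_add_single k hij hti s]
  rw [hconst] at hcomp
  exact hcomp.unique (hasDerivAt_const 0 _) ▸ rfl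

/-! ### The two genuine faces -/

/-- Inserting a zero commutes with scalar multiplication of tuples. [folklore] -/
theorem insertNth_zero_smul {k : ℕ} (i : Fin (k + 1)) (a : ℝ) (p : Fin k → ℝ) :
    (Fin.insertNth i (0 : ℝ) (a • p) : Fin (k + 1) → ℝ) = a • Fin.insertNth i (0 : ℝ) p := by
  ext j
  cases j using Fin.succAboveCases i with
  | x => simp
  | p j => simp [Fin.insertNth_apply_succAbove]

/-- Appending a zero commutes with scalar multiplication of tuples. [folklore] -/
theorem snoc_zero_smul {k : ℕ} (a : ℝ) (p : Fin k → ℝ) :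
    (Fin.snoc (a • p) (0 : ℝ) : Fin (k + 1) → ℝ) = a • Fin.snoc p (0 : ℝ) := by
  rw [← Fin.insertNth_last', ← Fin.insertNth_last', insertNth_zero_smul]

/-- **Front faces of the cube are facets of the simplex**: on the face `tᵢ = 1` the collapse is
the `i`-th coface `δᵢ = insertNth (castSucc i) 0` of the collapse one dimension down
(`i = 0, …, k`; the vertex `i` of `Δᵏ⁺¹` is omitted). [cite: HatcherAT2002, §2.1] -/
theorem cubeToSimplex_insertNth_one : ∀ (k : ℕ) (i : Fin (k + 1)) (x : Fin k → ℝ),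
    cubeToSimplex (k + 1) (i.insertNth 1 x) = (Fin.castSucc i).insertNth 0 (cubeToSimplex k x)
  | k, i, x => by
    induction k with
    | zero =>
      obtain rfl : i = 0 := Fin.eq_zero i
      rw [Fin.insertNth_zero', cubeToSimplex_succ, Fin.cons_zero, Fin.tail_cons, sub_self, one_smul,
        Fin.castSucc_zero, Fin.insertNth_zero']
    | succ k ih =>
      cases i using Fin.cases with
      | zero =>
        rw [Fin.insertNth_zero', cubeToSimplex_succ, Fin.cons_zero, Fin.tail_cons, sub_self, one_smul,
          Fin.castSucc_zero, Fin.insertNth_zero']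
      | succ i =>
        conv_lhs => rw [← Fin.cons_self_tail x, Fin.insertNth_succ_cons]
        rw [cubeToSimplex_succ, Fin.cons_zero, Fin.tail_cons, ih i (Fin.tail x),
          ← Fin.succ_castSucc, cubeToSimplex_succ, Fin.insertNth_succ_cons, insertNth_zero_smul]

/-- **The last back face of the cube is the last facet of the simplex**: on the face
`t_k = 0` (last coordinate) the collapse is the last coface `snoc · 0` of the collapse one
dimension down (the last vertex of `Δᵏ⁺¹` is omitted). [cite: HatcherAT2002, §2.1] -/
theorem cubeToSimplex_snoc_zero : ∀ (k : ℕ) (x : Fin k → ℝ),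
    cubeToSimplex (k + 1) (Fin.snoc x 0) = Fin.snoc (cubeToSimplex k x) 0
  | 0, x => by
    rw [cubeToSimplex_succ, cubeToSimplex_zero]
    have h0 : (Fin.snoc x (0 : ℝ) : Fin 1 → ℝ) 0 = 0 := by simp [Fin.snoc]
    rw [h0, sub_zero, zero_smul]
    ext j
    cases j using Fin.cases with
    | zero => simp [Fin.snoc]
    | succ j =>
      obtain rfl : j = 0 := Fin.eq_zero j
      simp [Fin.snoc]
  | k + 1, x => by
    conv_lhs => rw [← Fin.cons_self_tail x, ← Fin.cons_snoc_eq_snoc_cons]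
    rw [cubeToSimplex_succ, Fin.cons_zero, Fin.tail_cons, cubeToSimplex_snoc_zero k (Fin.tail x),
      cubeToSimplex_succ, ← Fin.cons_snoc_eq_snoc_cons, snoc_zero_smul]

/-- The last back face, `insertNth` form. [cite: HatcherAT2002, §2.1] -/
theorem cubeToSimplex_insertNth_last_zero (k : ℕ) (x : Fin k → ℝ) :
    cubeToSimplex (k + 1) ((Fin.last k).insertNth 0 x) = (Fin.last (k + 1)).insertNth 0 (cubeToSimplex k x) := by
  rw [Fin.insertNth_last', Fin.insertNth_last', cubeToSimplex_snoc_zero]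

/-- The collapse sends the origin to the vertex `e₀`. [folklore] -/
theorem cubeToSimplex_apply_zero_vec (k : ℕ) : cubeToSimplex k 0 = Pi.single 0 1 := by
  cases k with
  | zero => ext j; obtain rfl : j = 0 := Fin.eq_zero j; simp
  | succ k =>
    rw [cubeToSimplex_succ, Pi.zero_apply, sub_zero, zero_smul]
    ext j
    cases j using Fin.cases with
    | zero => simp
    | succ j => simp [Fin.succ_ne_zero]

/-! ### Agreement with the topological collapse of `CubeSimplexCollapse` -/

/-- The real coordinate function `m ↦ tₘ` (`0` past the last index), the ambient twin of
`CubeCollapse.tval`. [folklore] -/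
def coordR {k : ℕ} (t : Fin k → ℝ) (m : ℕ) : ℝ := if h : m < k then t ⟨m, h⟩ else 0

/-- The real partial products `∏_{m<j} tₘ` (with the factor `0` from `m = k` on), the ambient twin
of `CubeCollapse.pp`. [folklore] -/
def ppR {k : ℕ} (t : Fin k → ℝ) (j : ℕ) : ℝ := ∏ m ∈ Finset.range j, coordR t m

/-- `ppR t 0 = 1`. [folklore] -/
@[simp]
theorem ppR_zero {k : ℕ} (t : Fin k → ℝ) : ppR t 0 = 1 := by simp [ppR]

/-- The coordinate functions of the tail are the shifted coordinate functions. [folklore] -/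
theorem coordR_tail {k : ℕ} (t : Fin (k + 1) → ℝ) (m : ℕ) : coordR (Fin.tail t) m = coordR t (m + 1) := by
  unfold coordR
  by_cases h : m < k
  · rw [dif_pos h, dif_pos (by omega)]
    rfl
  · rw [dif_neg h, dif_neg (by omega)]

/-- The partial products of the tail: `P_{j+1}(t) = t₀ P_j(tail t)`. [folklore] -/
theorem ppR_succ_eq {k : ℕ} (t : Fin (k + 1) → ℝ) (j : ℕ) : ppR t (j + 1) = t 0 * ppR (Fin.tail t) j := by
  rw [ppR, Finset.prod_range_succ', ppR, mul_comm]
  congr 1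
  exact Finset.prod_congr rfl fun m _ ↦ (coordR_tail t m).symm

/-- **Closed formula for the collapse**: `(cubeToSimplex k t)ⱼ = Pⱼ - Pⱼ₊₁` with the partial
products `Pⱼ = t₀ ⋯ tⱼ₋₁` — the defining formula of `CubeCollapse.collapse`. [folklore] -/
theorem cubeToSimplex_apply_eq_ppR_sub : ∀ (k : ℕ) (t : Fin k → ℝ) (j : Fin (k + 1)),
    cubeToSimplex k t j = ppR t j - ppR t (j + 1)
  | 0, t, j => by
    obtain rfl : j = 0 := Fin.eq_zero j
    simp [ppR, coordR]
  | k + 1, t, j => by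
    cases j using Fin.cases with
    | zero =>
      rw [cubeToSimplex_succ_apply_zero, Fin.val_zero, ppR_zero]
      simp [ppR, coordR]
    | succ j =>
      rw [cubeToSimplex_succ_apply_succ, cubeToSimplex_apply_eq_ppR_sub k (Fin.tail t) j, Fin.val_succ,
        ppR_succ_eq, ppR_succ_eq]
      ring

open scoped unitInterval in
/-- On the cube, the real partial products are the tree's `CubeCollapse.pp` (up to the last
relevant index). [folklore] -/
theorem ppR_coe_eq_pp {k : ℕ} (t : Fin k → I) {j : ℕ} (hj : j ≤ k + 1) :
    ppR (fun i ↦ (t i : ℝ)) j = Literature.AlgebraicTopology.SingularHomology.CubeCollapse.pp t j := by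
  rw [Literature.AlgebraicTopology.SingularHomology.CubeCollapse.pp]
  by_cases hjk : j ≤ k
  · rw [if_pos hjk, ppR]
    rfl
  · obtain rfl : j = k + 1 := by omega
    rw [if_neg hjk, ppR]
    exact Finset.prod_eq_zero (Finset.mem_range.2 (Nat.lt_succ_self k)) (by simp [coordR])

open scoped unitInterval in
/-- **`cubeToSimplex` extends the topological collapse**: on the cube `Iᵏ` it is the tree's
`CubeCollapse.collapse` (`…SingularHomology.CubeSimplexCollapse`). [folklore] -/
theorem cubeToSimplex_coe_eq_collapse {k : ℕ} (t : Fin k → I) :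
    cubeToSimplex k (fun i ↦ (t i : ℝ)) =
      ((Literature.AlgebraicTopology.SingularHomology.CubeCollapse.collapse t :
        Literature.AlgebraicTopology.SingularHomology.StdSimplex k) : Fin (k + 1) → ℝ) := by
  funext j
  rw [Literature.AlgebraicTopology.SingularHomology.CubeCollapse.collapse_apply,
    cubeToSimplex_apply_eq_ppR_sub, ppR_coe_eq_pp t (by omega), ppR_coe_eq_pp t (by omega)]

end Literature.Geometry.Manifold
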